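import Summits.MatrixMultiplication.MatrixMultiplication.Theorems.ObstructionDescentUniversalOccurrenceTwoRectangleOddHookTableaux

set_option linter.dupNamespace false
set_option autoImplicit false

/-!
# Universal occurrence — two rectangles and the four-odd types `(2N-2j-3,2j+1,1,1)`: the value of `e_T`, uniform in `j`
(decomp-mm · lens 3 · gen 44, K32-B)

Route `route-MatrixMultiplication-ObstructionDescent` (sub-problem `MatrixMultiplication`, `ω(ℂ) = 2`); SUPPORT for the crux
`NoOccurrenceObstruction` (`P_O`, item `stmt-MatrixMultiplication-29040`), universal-occurrence programme.  No `def`, no `sorry`.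

The generic hook-domino tableau `T` of shape `(2N-2j-3,2j+1,1,1)` (`…TwoRectangleFourOddTableaux`: column `p ↦ (p,0)`, `p < 4`;
dominoes `2i+4 ↦ (0,i+1)`, `2i+5 ↦ (1,i+1)`, `i < 2j`; arm `p ↦ (0,p-2j-3)`, `p ≥ 4j+4`).  Here: the VALUE of the polytabloid
`e_T` on its support, UNIFORM IN `j` (the statements of `…TwoRectangleOddFiveSign` with `12 ↦ 4j+4`, `7 ↦ 2j+3` and the domino
sum `u(4)+u(6)+u(8)+u(10) ↦ Σ_{i<2j} u(2i+4)`).  §1: on a NORMALISED word (arm `0`, every domino read `0` over `1`, column read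
by `π ∈ S_4`) `e_T = sgn π` (`u = w_T ∘ π̃`, `π̃ ∈ C_T`); a domino flip (a transposition of `C_T`) changes the sign.  §2: by
induction on the number of dominoes read `1` over `0` (a `Finset` sum over the `2j` top cells), `e_T(u) = sgn π · (-1)^{Σ_i u(2i+4)}`
(`fourOddTableau_apply_eq_sign`) and, with `sgn` of the column reading as an inversion count (`sign_perm_fin_four_eq`), the parity
form `fourOddTableau_apply_eq_parity` used by the value files of the family (K32 of memo NODE-g44 §7).

[cite: BurgisserIkenmeyer2011, Thm. 4.4] [cite: BurgisserIkenmeyer2017, §5, Thm. 5.9 (proof of (2))]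
[cite: BurgisserIkenmeyerPanovaJAMS2019, §3(b) (3.5)] (polytabloids and column antisymmetry: folklore, Fulton, Young Tableaux, §7)
-/

noncomputable section

open scoped BigOperators

namespace Summit.MatrixMultiplication.MatrixMultiplication.Theorems.ObstructionCalculus

open Literature.Computability.AlgebraicComplexity
open Literature.NumberTheory.DiophantineGeometry

/-! ### §1 Normalised words and domino flips -/

/-- **`e_T` on a normalised word.**  If `u` vanishes on the arm, reads `0` over `1` down every domino and `π ∈ S_4` down the
column, then `e_T(u) = sgn π` (`u = w_T ∘ π̃` with `π̃ ∈ C_T` the extension of `π`). [folklore] -/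
theorem fourOddTableau_apply_of_normal {N j : ℕ} {Y : YoungDiagram} (hN : ∀ x ∈ Y.cells, x.1 < N) (T : StdFilling (N * 2) Y)
    (hT : ∀ p : Fin (N * 2), T.1 p =
      (if (p : ℕ) < 4 then ((p : ℕ), 0) else if (p : ℕ) < 4 * j + 4 then ((p : ℕ) % 2, (p : ℕ) / 2 - 1) else (0, (p : ℕ) - (2 * j + 3))))
    (hj : 4 * j + 4 ≤ N * 2) {u : Word N (N * 2)} (harm : ∀ p : Fin (N * 2), 4 * j + 4 ≤ (p : ℕ) → ((u p : Fin N) : ℕ) = 0)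
    (hdom : ∀ p : Fin (N * 2), 4 ≤ (p : ℕ) → (p : ℕ) < 4 * j + 4 → ((u p : Fin N) : ℕ) = (p : ℕ) % 2)
    (π : Equiv.Perm (Fin 4)) (hπ : ∀ (p : Fin (N * 2)) (hp : (p : ℕ) < 4), ((π ⟨p, hp⟩ : Fin 4) : ℕ) = ((u p : Fin N) : ℕ)) :
    T.polytabloid ℂ hN u = ((Equiv.Perm.sign π : ℤ) : ℂ) := by
  classical
  let f : Fin 4 ≃ {p : Fin (N * 2) // (p : ℕ) < 4} :=
    { toFun := fun i => ⟨⟨i, by omega⟩, i.2⟩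
      invFun := fun p => ⟨p.1, p.2⟩
      left_inv := fun i => Fin.ext rfl
      right_inv := fun p => Subtype.ext (Fin.ext rfl) }
  obtain ⟨E, hE⟩ : ∃ E : Equiv.Perm (Fin (N * 2)), E = π.extendDomain f := ⟨_, rfl⟩
  have hE_lt : ∀ (p : Fin (N * 2)) (hp : (p : ℕ) < 4), ((E p : Fin (N * 2)) : ℕ) = ((π ⟨p, hp⟩ : Fin 4) : ℕ) := by
    intro p hp
    rw [hE, Equiv.Perm.extendDomain_apply_subtype π f hp]
    rfl
  have hE_ge : ∀ p : Fin (N * 2), ¬ (p : ℕ) < 4 → E p = p := fun p hp => by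
    rw [hE]; exact Equiv.Perm.extendDomain_apply_not_subtype π f hp
  have hrow' : ∀ q : Fin (N * 2), (T.1 q).1 =
      if (q : ℕ) < 4 then (q : ℕ) else if (q : ℕ) < 4 * j + 4 then (q : ℕ) % 2 else 0 := fun q => by
    rw [hT]; split_ifs <;> rfl
  have hcol' : ∀ q : Fin (N * 2), (T.1 q).2 =
      if (q : ℕ) < 4 then 0 else if (q : ℕ) < 4 * j + 4 then (q : ℕ) / 2 - 1 else (q : ℕ) - (2 * j + 3) := fun q => by
    rw [hT]; split_ifs <;> rfl
  have hEcol : E ∈ T.colStab := StdFilling.mem_colStab.2 fun p => by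
    rw [hcol', hcol']
    by_cases hp : (p : ℕ) < 4
    · have h2' : ((E p : Fin (N * 2)) : ℕ) < 4 := by rw [hE_lt p hp]; exact (π ⟨p, hp⟩).2
      rw [if_pos h2', if_pos hp]
    · rw [hE_ge p hp]
  have hu : u = T.rowWord hN ∘ ⇑E := by
    funext p
    apply Fin.ext
    show ((u p : Fin N) : ℕ) = (T.1 (E p)).1
    rw [hrow']
    by_cases hp : (p : ℕ) < 4
    · have h1' := hE_lt p hp
      have h2' : ((E p : Fin (N * 2)) : ℕ) < 4 := by rw [h1']; exact (π ⟨p, hp⟩).2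
      rw [if_pos h2', h1', hπ p hp]
    · rw [hE_ge p hp, if_neg hp]
      by_cases hp' : (p : ℕ) < 4 * j + 4
      · rw [if_pos hp', hdom p (by omega) hp']
      · rw [if_neg hp', harm p (by omega)]
  have h := congrFun (StdFilling.wordPerm_polytabloid_of_mem_colStab (k := ℂ) hN T hEcol) (T.rowWord hN)
  rw [wordPerm_apply, Pi.smul_apply, smul_eq_mul, StdFilling.polytabloid_apply_rowWord, mul_one] at h
  rw [hu, h, hE, Equiv.Perm.sign_extendDomain]

/-- **Domino flip.**  Exchanging the two cells of a domino (a transposition of `C_T`) changes the sign of `e_T`.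
[cite: BurgisserIkenmeyerPanovaJAMS2019, §3(b) (3.5)] -/
theorem fourOddTableau_apply_comp_swap {N j : ℕ} {Y : YoungDiagram} (hN : ∀ x ∈ Y.cells, x.1 < N) (T : StdFilling (N * 2) Y)
    (hT : ∀ p : Fin (N * 2), T.1 p =
      (if (p : ℕ) < 4 then ((p : ℕ), 0) else if (p : ℕ) < 4 * j + 4 then ((p : ℕ) % 2, (p : ℕ) / 2 - 1) else (0, (p : ℕ) - (2 * j + 3))))
    {a b : Fin (N * 2)} (ha : 4 ≤ (a : ℕ)) (hb : (b : ℕ) = (a : ℕ) + 1) (hb12 : (b : ℕ) < 4 * j + 4) (hae : (a : ℕ) % 2 = 0)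
    (u : Word N (N * 2)) : T.polytabloid ℂ hN u = -T.polytabloid ℂ hN (u ∘ ⇑(Equiv.swap a b)) := by
  classical
  have hcol' : ∀ q : Fin (N * 2), (T.1 q).2 =
      if (q : ℕ) < 4 then 0 else if (q : ℕ) < 4 * j + 4 then (q : ℕ) / 2 - 1 else (q : ℕ) - (2 * j + 3) := fun q => by
    rw [hT]; split_ifs <;> rfl
  have hab : a ≠ b := fun h => by have := congrArg Fin.val h; omega
  have hτ : Equiv.swap a b ∈ T.colStab :=
    StdFilling.swap_mem_colStab (by rw [hcol', hcol']; split_ifs <;> omega)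
  have h := congrFun (StdFilling.wordPerm_polytabloid_of_mem_colStab (k := ℂ) hN T hτ) u
  rw [wordPerm_apply, Pi.smul_apply, smul_eq_mul, Equiv.Perm.sign_swap hab] at h
  rw [h]
  simp

/-! ### §2 The value of `e_T` on its support -/

set_option maxHeartbeats 400000 in
/-- **`e_T(u) = sgn π · (-1)^{Σ_i u(2i+4)}`** on the support, by induction on the number `c` of dominoes read `1` over `0`.
[folklore] -/
theorem fourOddTableau_apply_eq_sign {N j : ℕ} {Y : YoungDiagram} (hN : ∀ x ∈ Y.cells, x.1 < N) (T : StdFilling (N * 2) Y)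
    (hT : ∀ p : Fin (N * 2), T.1 p =
      (if (p : ℕ) < 4 then ((p : ℕ), 0) else if (p : ℕ) < 4 * j + 4 then ((p : ℕ) % 2, (p : ℕ) / 2 - 1)
        else (0, (p : ℕ) - (2 * j + 3))))
    (hj : 4 * j + 4 ≤ N * 2) (π : Equiv.Perm (Fin 4)) :
    ∀ (c : ℕ) (u : Word N (N * 2)),
      (∑ i : Fin (2 * j), ((u ⟨2 * (i : ℕ) + 4, by have := i.2; omega⟩ : Fin N) : ℕ)) = c →
      (∀ p : Fin (N * 2), 4 * j + 4 ≤ (p : ℕ) → ((u p : Fin N) : ℕ) = 0) →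
      (∀ (p : Fin (N * 2)) (hp : (p : ℕ) < 4), ((π ⟨p, hp⟩ : Fin 4) : ℕ) = ((u p : Fin N) : ℕ)) →
      (∀ p q : Fin (N * 2), 4 ≤ (p : ℕ) → (q : ℕ) < 4 * j + 4 → (q : ℕ) = (p : ℕ) + 1 → (p : ℕ) % 2 = 0 →
        ((u p : Fin N) : ℕ) + ((u q : Fin N) : ℕ) = 1) →
      T.polytabloid ℂ hN u = ((Equiv.Perm.sign π : ℤ) : ℂ) * (if c % 2 = 0 then 1 else -1) := by
  classical
  -- the top cells of the dominoes
  have top_surj : ∀ q : Fin (N * 2), 4 ≤ (q : ℕ) → (q : ℕ) < 4 * j + 4 → (q : ℕ) % 2 = 0 →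
      ∃ i : Fin (2 * j), (⟨2 * (i : ℕ) + 4, by have := i.2; omega⟩ : Fin (N * 2)) = q := by
    intro q h4 hlt he
    exact ⟨⟨((q : ℕ) - 4) / 2, by omega⟩, Fin.ext (by simp only; omega)⟩
  intro c
  induction c with
  | zero =>
    intro u hc harm hπ hds
    have htop : ∀ i : Fin (2 * j), ((u ⟨2 * (i : ℕ) + 4, by have := i.2; omega⟩ : Fin N) : ℕ) = 0 := fun i =>
      (Finset.sum_eq_zero_iff.1 hc) i (Finset.mem_univ i)
    rw [fourOddTableau_apply_of_normal hN T hT hj harm ?_ π hπ]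
    · simp
    intro p hp4 hpj
    by_cases hpe : (p : ℕ) % 2 = 0
    · obtain ⟨i, hi⟩ := top_surj p hp4 hpj hpe
      rw [hpe, ← hi]; exact htop i
    · obtain ⟨q, hq⟩ : ∃ q : Fin (N * 2), (q : ℕ) = (p : ℕ) - 1 := ⟨⟨(p : ℕ) - 1, by omega⟩, rfl⟩
      have h := hds q p (by omega) hpj (by omega) (by omega)
      obtain ⟨i, hi⟩ := top_surj q (by omega) (by omega) (by omega)
      have h0 := htop i
      rw [hi] at h0
      omega
  | succ c ih =>
    intro u hc harm hπ hds
    have hle : ∀ i : Fin (2 * j), ((u ⟨2 * (i : ℕ) + 4, by have := i.2; omega⟩ : Fin N) : ℕ) ≤ 1 := by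
      intro i
      obtain ⟨r, hr⟩ : ∃ r : Fin (N * 2), (r : ℕ) = 2 * (i : ℕ) + 5 := ⟨⟨2 * (i : ℕ) + 5, by have := i.2; omega⟩, rfl⟩
      have h := hds ⟨2 * (i : ℕ) + 4, by have := i.2; omega⟩ r (by simp) (by have := i.2; omega)
        (by rw [hr]) (by simp only; omega)
      omega
    -- a domino read `1` over `0`
    obtain ⟨i, -, hi⟩ := Finset.exists_ne_zero_of_sum_ne_zero (by rw [hc]; exact Nat.succ_ne_zero c)
    obtain ⟨a, ha⟩ : ∃ a : Fin (N * 2), a = ⟨2 * (i : ℕ) + 4, by have := i.2; omega⟩ := ⟨_, rfl⟩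
    have hav : (a : ℕ) = 2 * (i : ℕ) + 4 := by rw [ha]
    have hua : ((u a : Fin N) : ℕ) = 1 := by have l := hle i; rw [← ha] at l hi; omega
    obtain ⟨b, hb⟩ : ∃ b : Fin (N * 2), (b : ℕ) = (a : ℕ) + 1 := ⟨⟨(a : ℕ) + 1, by have := i.2; omega⟩, rfl⟩
    have hub : ((u b : Fin N) : ℕ) = 0 := by
      have h := hds a b (by omega) (by have := i.2; omega) hb (by rw [hav]; omega)
      omega
    -- the flipped word `u ∘ (a b)`
    have hfix : ∀ q : Fin (N * 2), (q : ℕ) ≠ (a : ℕ) → (q : ℕ) ≠ (b : ℕ) → (u ∘ ⇑(Equiv.swap a b)) q = u q :=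
      fun q hqa hqb => by
        show u (Equiv.swap a b q) = u q
        rw [Equiv.swap_apply_of_ne_of_ne (fun h => hqa (congrArg Fin.val h)) (fun h => hqb (congrArg Fin.val h))]
    have hfa : (u ∘ ⇑(Equiv.swap a b)) a = u b := by
      show u (Equiv.swap a b a) = u b
      rw [Equiv.swap_apply_left]
    have hfb : (u ∘ ⇑(Equiv.swap a b)) b = u a := by
      show u (Equiv.swap a b b) = u a
      rw [Equiv.swap_apply_right]
    -- the domino sum drops by one
    have hsplit := Finset.add_sum_erase (Finset.univ : Finset (Fin (2 * j)))
      (fun i' : Fin (2 * j) => ((u ⟨2 * (i' : ℕ) + 4, by have := i'.2; omega⟩ : Fin N) : ℕ)) (Finset.mem_univ i)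
    have hsplit' := Finset.add_sum_erase (Finset.univ : Finset (Fin (2 * j)))
      (fun i' : Fin (2 * j) => (((u ∘ ⇑(Equiv.swap a b)) ⟨2 * (i' : ℕ) + 4, by have := i'.2; omega⟩ : Fin N) : ℕ))
      (Finset.mem_univ i)
    have hrest : (∑ i' ∈ (Finset.univ : Finset (Fin (2 * j))).erase i,
        (((u ∘ ⇑(Equiv.swap a b)) ⟨2 * (i' : ℕ) + 4, by have := i'.2; omega⟩ : Fin N) : ℕ)) =
        ∑ i' ∈ (Finset.univ : Finset (Fin (2 * j))).erase i,
          ((u ⟨2 * (i' : ℕ) + 4, by have := i'.2; omega⟩ : Fin N) : ℕ) := by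
      refine Finset.sum_congr rfl fun i' hi' => ?_
      have hne : i' ≠ i := (Finset.mem_erase.1 hi').1
      have hne' : (i' : ℕ) ≠ (i : ℕ) := fun h => hne (Fin.ext h)
      rw [hfix _ (by simp only; omega) (by simp only; omega)]
    have hc' : (∑ i' : Fin (2 * j),
        (((u ∘ ⇑(Equiv.swap a b)) ⟨2 * (i' : ℕ) + 4, by have := i'.2; omega⟩ : Fin N) : ℕ)) = c := by
      have h1 : (((u ∘ ⇑(Equiv.swap a b)) ⟨2 * (i : ℕ) + 4, by have := i.2; omega⟩ : Fin N) : ℕ) = 0 := by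
        rw [← ha, hfa, hub]
      have h2 : ((u ⟨2 * (i : ℕ) + 4, by have := i.2; omega⟩ : Fin N) : ℕ) = 1 := by rw [← ha, hua]
      simp only [h1, h2] at hsplit hsplit'
      omega
    rw [fourOddTableau_apply_comp_swap hN T hT (a := a) (b := b) (by omega) hb (by have := i.2; omega)
        (by rw [hav]; omega) u,
      ih (u ∘ ⇑(Equiv.swap a b)) hc' ?_ ?_ ?_]
    · by_cases hce : c % 2 = 0
      · rw [if_pos hce, if_neg (by omega)]; ring
      · rw [if_neg hce, if_pos (by omega)]; ring
    · intro q hq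
      rw [hfix q (by have := i.2; omega) (by have := i.2; omega)]
      exact harm q hq
    · intro q hq
      rw [hfix q (by omega) (by omega)]
      exact hπ q hq
    · intro p q hp hq hqp hpe
      by_cases hpa : (p : ℕ) = (a : ℕ)
      · have ep : p = a := Fin.ext hpa
        have eq : q = b := Fin.ext (by omega)
        rw [ep, eq, hfa, hfb]
        omega
      · rw [hfix p hpa (by omega), hfix q (by omega) (by omega)]
        exact hds p q hp hq hqp hpe

set_option maxHeartbeats 400000 in
/-- **Value of `e_T` on a support word, as a parity.**  `e_T(u) = (-1)^{#inversions of the column reading + Σ_i u(2i+4)}`.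
[folklore] -/
theorem fourOddTableau_apply_eq_parity {N j : ℕ} {Y : YoungDiagram} (hN : ∀ x ∈ Y.cells, x.1 < N)
    (T : StdFilling (N * 2) Y)
    (hT : ∀ p : Fin (N * 2), T.1 p =
      (if (p : ℕ) < 4 then ((p : ℕ), 0) else if (p : ℕ) < 4 * j + 4 then ((p : ℕ) % 2, (p : ℕ) / 2 - 1) else (0, (p : ℕ) - (2 * j + 3))))
    (hj : 4 * j + 4 ≤ N * 2) {u : Word N (N * 2)} (harm : ∀ p : Fin (N * 2), 4 * j + 4 ≤ (p : ℕ) → ((u p : Fin N) : ℕ) = 0)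
    (hlt : ∀ p : Fin (N * 2), (p : ℕ) < 4 → ((u p : Fin N) : ℕ) < 4)
    (hinj : ∀ p q : Fin (N * 2), (p : ℕ) < 4 → (q : ℕ) < 4 → u p = u q → p = q)
    (hds : ∀ p q : Fin (N * 2), 4 ≤ (p : ℕ) → (q : ℕ) < 4 * j + 4 → (q : ℕ) = (p : ℕ) + 1 → (p : ℕ) % 2 = 0 →
      ((u p : Fin N) : ℕ) + ((u q : Fin N) : ℕ) = 1) :
    T.polytabloid ℂ hN u =
      if ((if ((u ⟨1, by omega⟩ : Fin N) : ℕ) < ((u ⟨0, by omega⟩ : Fin N) : ℕ) then 1 else 0) +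
          (if ((u ⟨2, by omega⟩ : Fin N) : ℕ) < ((u ⟨0, by omega⟩ : Fin N) : ℕ) then 1 else 0) +
          (if ((u ⟨3, by omega⟩ : Fin N) : ℕ) < ((u ⟨0, by omega⟩ : Fin N) : ℕ) then 1 else 0) +
          (if ((u ⟨2, by omega⟩ : Fin N) : ℕ) < ((u ⟨1, by omega⟩ : Fin N) : ℕ) then 1 else 0) +
          (if ((u ⟨3, by omega⟩ : Fin N) : ℕ) < ((u ⟨1, by omega⟩ : Fin N) : ℕ) then 1 else 0) +
          (if ((u ⟨3, by omega⟩ : Fin N) : ℕ) < ((u ⟨2, by omega⟩ : Fin N) : ℕ) then 1 else 0) +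
          ∑ i : Fin (2 * j), ((u ⟨2 * (i : ℕ) + 4, by have := i.2; omega⟩ : Fin N) : ℕ)) % 2 = 0
      then 1 else -1 := by
  classical
  let g : Fin 4 → Fin 4 := fun i => ⟨((u ⟨i, by omega⟩ : Fin N) : ℕ), hlt _ (by simp)⟩
  have hg : Function.Injective g := by
    intro i j hij
    have h1 : ((u ⟨i, by omega⟩ : Fin N) : ℕ) = ((u ⟨j, by omega⟩ : Fin N) : ℕ) := by
      have h := Fin.ext_iff.1 hij
      exact h
    have h2 := hinj ⟨i, by omega⟩ ⟨j, by omega⟩ (by simp) (by simp) (Fin.ext h1)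
    exact Fin.ext (by simpa using congrArg Fin.val h2)
  let π : Equiv.Perm (Fin 4) := Equiv.ofBijective g (Finite.injective_iff_bijective.1 hg)
  have hπ : ∀ (p : Fin (N * 2)) (hp : (p : ℕ) < 4), ((π ⟨p, hp⟩ : Fin 4) : ℕ) = ((u p : Fin N) : ℕ) := fun p hp => rfl
  have e0 : ((π 0 : Fin 4) : ℕ) = ((u ⟨0, by omega⟩ : Fin N) : ℕ) := rfl
  have e1 : ((π 1 : Fin 4) : ℕ) = ((u ⟨1, by omega⟩ : Fin N) : ℕ) := rfl
  have e2 : ((π 2 : Fin 4) : ℕ) = ((u ⟨2, by omega⟩ : Fin N) : ℕ) := rfl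
  have e3 : ((π 3 : Fin 4) : ℕ) = ((u ⟨3, by omega⟩ : Fin N) : ℕ) := rfl
  rw [fourOddTableau_apply_eq_sign hN T hT hj π _ u rfl harm hπ hds, sign_perm_fin_four_eq π, e0, e1, e2, e3]
  generalize ((if ((u ⟨1, by omega⟩ : Fin N) : ℕ) < ((u ⟨0, by omega⟩ : Fin N) : ℕ) then 1 else 0) +
      (if ((u ⟨2, by omega⟩ : Fin N) : ℕ) < ((u ⟨0, by omega⟩ : Fin N) : ℕ) then 1 else 0) +
      (if ((u ⟨3, by omega⟩ : Fin N) : ℕ) < ((u ⟨0, by omega⟩ : Fin N) : ℕ) then 1 else 0) +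
      (if ((u ⟨2, by omega⟩ : Fin N) : ℕ) < ((u ⟨1, by omega⟩ : Fin N) : ℕ) then 1 else 0) +
      (if ((u ⟨3, by omega⟩ : Fin N) : ℕ) < ((u ⟨1, by omega⟩ : Fin N) : ℕ) then 1 else 0) +
      (if ((u ⟨3, by omega⟩ : Fin N) : ℕ) < ((u ⟨2, by omega⟩ : Fin N) : ℕ) then 1 else 0) : ℕ) = I
  generalize (∑ i : Fin (2 * j), ((u ⟨2 * (i : ℕ) + 4, by have := i.2; omega⟩ : Fin N) : ℕ) : ℕ) = c
  by_cases hI : I % 2 = 0 <;> by_cases hc : c % 2 = 0 <;> simp only [hI, hc, if_true, if_false] <;> split_ifs <;>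
    first | (exfalso; omega) | norm_num

end Summit.MatrixMultiplication.MatrixMultiplication.Theorems.ObstructionCalculus

end
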